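/-
Copyright (c) 2026 the pub-hodgecm-mathlib formalisation cell (harness21).  Prover seat hodgecm-mathlib-K2Liu-p08 (g4), Track B «K2-LIT» ∕ hLiu418
#184♮, socket #42S organ S1 (ROAD W), brick F8 (T3-frame-split (i-c)) (LEAD F0P6-plan (g14) BATCH #6 (4); K2Liu-p01 (g8) SPEC-F7-FrameStep ab42186030930277
§2 (i-c) `tau_trace_dual_herm` — its SPLIT twin is the self-duality of the full matrix box).  2026-09-04.  KERNEL: theorems only.
-/
import Mathlib.RingTheory.Valuation.Basic
import Mathlib.LinearAlgebra.Matrix.Trace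
import Mathlib.Data.Matrix.Basis
import HarnessLib

/-!
# Crux `HLiu418`, #42S-S1 ROAD W, brick F8 (T3-frame-split (i-c)): THE MATRIX BOX IS SELF-DUAL UNDER THE TRACE PAIRING

Cell `hodgecm-mathlib`, crux item hLiu418 = `stmt-HodgeConjecture-24832` (helper lane `--supports … --as helper`, count-neutral).  THEOREMS ONLY (no `def`, no instance,
no notation, no named-fact hypothesis, no `sorry`).  GENERIC over a valuation `v : Valuation R Γ₀` on a commutative ring (used at `R = L⁺_v` ∕ `L_{w₀}`): at a place `v` SPLIT in `L` the
★ reading `K2LiuLocalRingSplitReading` turns the hermitian pairing `τ(tr(H·G))` of K2Liu-p01 (g8)'s frame step (SPEC-F7-FrameStep §1) into `2·tr(H′·K)` with `H′ ∈ M₂(L⁺_v)` FREE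
(the `w₀`-component of a hermitian `H` is unconstrained) and `K = A′B″ᵀ + B′A″ᵀ + d·C′C″ᵀ` (★ reading `reading_gram_fst`); so the split (i-c) is the self-duality of the FULL box
`M_n(𝒪)` under `(Y, K) ↦ tr(Y·K)` — perfect in every residue characteristic, no dyadic seam beyond the scalar `2d` that the box normalisation `c₀` absorbs (p01's fix (S-dyadic)):
* `trace_single_mul_eq` (`tr(E_{ji}·K) = K_{ij}`), `valuation_trace_mul_le` (ultrametric bound), HEAD **`forall_valuation_trace_mul_le_iff`**:
  `(∀ Y, (∀ a b, v(Y a b) ≤ 1) → v(tr(Y·K)) ≤ s) ↔ ∀ i j, v(K i j) ≤ s`; and the ideal form **`forall_trace_mul_mem_iff`** (`I` an ideal: `(∀ Y, tr(Y·K) ∈ I) ↔ ∀ i j, K i j ∈ I`).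
[CasselsFrohlichANT1967, Ch. II §10] [Shimura1997, §13.2] [Weil1964, §20 (self-dual lattices)].
HONEST LABEL.  Count-neutral helper; `HC_CM` is proved only modulo the 7 printed citations (2 remaining named inputs: hLiu418 = `stmt-HodgeConjecture-24832`,
h413 = `stmt-HodgeConjecture-24833`) until rung 0 closes.

## References
* [CasselsFrohlichANT1967] J. W. S. Cassels, A. Fröhlich (eds.), *Algebraic Number Theory* (1967), Ch. II §10.   * [Shimura1997] G. Shimura, CBMS 93 (1997), §13.2.
* [Weil1964] A. Weil, Sur certains groupes d'opérateurs unitaires, Acta Math. 111 (1964), §20.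
-/

set_option autoImplicit false
set_option linter.dupNamespace false -- the mandated namespace repeats `HodgeConjecture.HodgeConjecture`

open Matrix

namespace Summit.HodgeConjecture.HodgeConjecture.Cruxes.HLiu418.K2LiuTraceDualityMatrixBox

variable {R : Type*} [CommRing R] {n : Type*} [Fintype n] [DecidableEq n]

/-- `tr(E_{ji}·K) = K_{ij}` (Mathlib `trace_single_mul`). [folklore] -/
theorem trace_single_mul_eq (K : Matrix n n R) (i j : n) : trace (single j i (1 : R) * K) = K i j := by
  rw [trace_single_mul, smul_eq_mul, one_mul]

/-- **IDEAL FORM**: `(∀ Y, tr(Y·K) ∈ I) ↔ ∀ i j, K i j ∈ I` (test with the elementary matrices; conversely `tr(Y·K) = Σ Y_{ab} K_{ba}`). [cite: Weil1964, §20] -/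
theorem forall_trace_mul_mem_iff (I : Ideal R) (K : Matrix n n R) : (∀ Y : Matrix n n R, trace (Y * K) ∈ I) ↔ ∀ i j, K i j ∈ I := by
  constructor
  · intro h i j
    rw [← trace_single_mul_eq K i j]
    exact h _
  · intro h Y
    rw [trace]
    refine I.sum_mem fun a _ => ?_
    rw [diag_apply, mul_apply]
    exact I.sum_mem fun b _ => I.mul_mem_left _ (h b a)

variable {Γ₀ : Type*} [LinearOrderedCommGroupWithZero Γ₀] (v : Valuation R Γ₀)

omit [DecidableEq n] in
/-- ultrametric bound: if `v(Y a b) ≤ 1` and `v(K i j) ≤ s` for all entries then `v(tr(Y·K)) ≤ s`. [cite: CasselsFrohlichANT1967, Ch. II §10] -/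
theorem valuation_trace_mul_le {Y K : Matrix n n R} {s : Γ₀} (hY : ∀ a b, v (Y a b) ≤ 1) (hK : ∀ i j, v (K i j) ≤ s) : v (trace (Y * K)) ≤ s := by
  rw [trace]
  refine v.map_sum_le fun a _ => ?_
  rw [diag_apply, mul_apply]
  refine v.map_sum_le fun b _ => ?_
  rw [map_mul]
  calc v (Y a b) * v (K b a) ≤ 1 * s := mul_le_mul' (hY a b) (hK b a)
    _ = s := one_mul s

/-- **THE MATRIX BOX IS SELF-DUAL UNDER THE TRACE PAIRING** (HEAD): `(∀ Y ∈ M_n(𝒪), v(tr(Y·K)) ≤ s) ↔ ∀ i j, v(K i j) ≤ s` — the split-place (i-c) of the frame step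
(`𝔰₀^⊥` read at `w₀` is the full box). [cite: Weil1964, §20] [cite: Shimura1997, §13.2] -/
theorem forall_valuation_trace_mul_le_iff (K : Matrix n n R) (s : Γ₀) :
    (∀ Y : Matrix n n R, (∀ a b, v (Y a b) ≤ 1) → v (trace (Y * K)) ≤ s) ↔ ∀ i j, v (K i j) ≤ s := by
  constructor
  · intro h i j
    rw [← trace_single_mul_eq K i j]
    refine h _ fun a b => ?_
    simp only [Matrix.single, of_apply]
    split_ifs
    · exact le_of_eq (map_one v)
    · rw [map_zero]
      exact zero_le
  · intro h Y hY
    exact valuation_trace_mul_le v hY h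

/-- scaled form: `(∀ Y ∈ M_n(𝒪), v(c·tr(Y·K)) ≤ s) ↔ ∀ i j, v(c·K i j) ≤ s` for any scalar `c` (e.g. `c = ϖ^{−m}`, the box `𝔰_{Λ_m} = ϖ^{−m}𝔰_{Λ₀}`; or `c = 2`, `(2d)⁻¹`).
[cite: Weil1964, §20] -/
theorem forall_valuation_mul_trace_mul_le_iff (c : R) (K : Matrix n n R) (s : Γ₀) :
    (∀ Y : Matrix n n R, (∀ a b, v (Y a b) ≤ 1) → v (c * trace (Y * K)) ≤ s) ↔ ∀ i j, v (c * K i j) ≤ s := by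
  have e : ∀ Y : Matrix n n R, c * trace (Y * K) = trace (Y * (c • K)) := fun Y => by
    rw [Matrix.mul_smul, trace_smul, smul_eq_mul]
  simp only [e, forall_valuation_trace_mul_le_iff v (c • K) s, smul_apply, smul_eq_mul]

end Summit.HodgeConjecture.HodgeConjecture.Cruxes.HLiu418.K2LiuTraceDualityMatrixBox
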